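/-
Copyright: the b2b-balaban T⁴-continuum CRUX team, row NE7b OWNER lineage `t4-ne7b-p1` (gen 137). Project licence.
-/
import Summits.QuantumFields.BalabanUV.T4Continuum.Spine.NE7b.SupBlockEffectiveActionThirdDerivative
import Summits.QuantumFields.BalabanUV.T4Continuum.Spine.NE7b.SupBlockFourthMoment

/-!
# THE THIRD DERIVATIVE IN TILTED FORM — the joint third cumulant, the class-closure plan, item (d).  For a `C³` block input with the four
# block letters over `N(0,M⁻¹)`, (419)'s trilinear `T(ψ)` applied to directions `h, k, l` is ONE tilted expectation of a CENTRED integrand: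
# with `ν = Z⁻¹e^{−U(ω+ψ)}dN(0,M⁻¹)`, `A_v = U′(ω+ψ)[v]`, `B_vw = U″(ω+ψ)[v,w]`, `C = U‴(ω+ψ)[h,k,l]`, `a_v = E_νA_v`,
#   `T(ψ)[h,k,l] = E_ν[ C − (A_k−a_k)B_hl − B_hk(A_l−a_l) − (A_h−a_h)B_kl + (A_h−a_h)(A_k−a_k)(A_l−a_l) ]`
# (`= E[C] − ΣCov(A,B) + κ₃(A_h,A_k,A_l)`).  THIS FILE does the unfolding: the raw term of (419) through `integral_apply` (three levels) into
# scalar tilted integrals `Z⁻¹∫Φ[h,k,l] + Z⁻²(G_hH_kl + G_kH_hl + H_hkG_l) + 2Z⁻³G_hG_kG_l`; the regrouping into the centred display (linearity)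
# and the uniform bound it yields ((423)'s concentration) are the successor's (row NE7b, node U5c; (418)∕(419)∕(423) BY NAME;
# [folklore])

Cell `pub-balaban`, sub-cell `t4`, spine estimate NE7b (`T4WeightBudget.RelWeightBound`; the cell's OWN estimate — NOT PRINTED in
[Bałaban 1983–89], NOT PROVED).  Crux-route work under `Spine/NE7b/` by the row OWNER (`t4-ne7b-p1` gen 137, file (424)) under FREEZE
(0)'s crux-prover clause (this gen's class-closure audit, item (d)); NOTHING of Bałaban's is named as a Lean object, valued or asserted; no
`T4Continuum/Support` leaf typed; no `def`, no notation (`T` WRITTEN OUT as in (419)); zero `sorry`.  Imports (BY NAME): the OWNER's (419)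
`…SupBlockEffectiveActionThirdDerivative` (the object) and through it (418) (`continuous_weightedBlockHess_deriv`, `block_third_domination_op`),
(402)∕(403) (`integrable_weighted_blockDeriv`, `integrable_weightedBlockHess`), (423) `…SupBlockFourthMoment` (`integrable_block_moments`), (400)
(`integrable_weighted_blockDeriv_apply`), (399), (313) (`integrable_domination`).

WHAT IS PROVED ([folklore]):
* §1 `phi_apply` (the product-rule integrand on three directions), `integrable_phi`, `integral_phi_apply`, `integral_G_apply`, `integral_H_apply`,
  THE END **`hessW_deriv_apply`** (`T(ψ)[h,k,l] = Z⁻¹∫Φ[h,k,l] + Z⁻²(G_hH_kl + G_kH_hl + H_hkG_l) + 2Z⁻³G_hG_kG_l` with every term a scalar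
  integral against `e^{−U(ω+ψ)}dN(0,M⁻¹)`); the regrouping into the CENTRED display is the successor's first lemma; §2 toy.

HONEST (what this is NOT).  An identity; the uniform bound `κ₃⁺` and the assembly are the successor's; no contraction ((β4)), no
decaying-covariance polymer expansion ((β3′)); scalar skeleton ((A3), NC-NE7b-α UNRULED); nothing of Bałaban's asserted.  BY-NAME EFFECT ON THE
WALL: NONE.  NE7b NOT PRINTED ∕ NOT PROVED; spine PROVED 0∕9; rung (B)+1 — the programme's measures remain FINITE-torus statements; NOT the mass gap,
NOT Clay.  HONEST DEPENDENCY: continuum YM on T⁴ ⇐ BetaPertH ∧ nine spine estimates (0∕9 proved); BetaPertH ⇐ (D1) ∧ (D4) ∧ CAP+tail; G-an2-4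
gates asym, D1 and NE2∕3∕4.
-/

set_option autoImplicit false
set_option maxSynthPendingDepth 3

noncomputable section

namespace Summit.QuantumFields.BalabanUV.T4Continuum.NE7b.SupBlockThirdCumulantForm

open MeasureTheory ProbabilityTheory Finset Real Metric
open scoped BigOperators Matrix
open SupEffectiveActionDerivative (integrable_domination mul_opBound_le_of_le)
open SupBlockEffectiveActionDerivative (integrable_weighted_blockDeriv integrable_exp_neg_block)
open SupBlockUpperLetter (integrable_weighted_blockDeriv_apply)
open SupBlockEffectiveActionCovariance (integrable_weightedBlockHess)
open SupBlockEffectiveActionThird (continuous_weightedBlockHess_deriv block_third_domination_op)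
open SupBlockFourthMoment (integrable_block_moments)

variable {ι : Type} [Fintype ι] [DecidableEq ι]

section Main

variable {M : Matrix ι ι ℝ} {γop m lam : ℝ} {U : EuclideanSpace ℝ ι → ℝ} {U' : EuclideanSpace ℝ ι → EuclideanSpace ℝ ι →L[ℝ] ℝ}
  {U'' : EuclideanSpace ℝ ι → EuclideanSpace ℝ ι →L[ℝ] EuclideanSpace ℝ ι →L[ℝ] ℝ}
  {U₃ : EuclideanSpace ℝ ι → EuclideanSpace ℝ ι →L[ℝ] EuclideanSpace ℝ ι →L[ℝ] EuclideanSpace ℝ ι →L[ℝ] ℝ} {κ₀ κ₁ κ₂ κ₃ a τ δ θ : ℝ}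

/-! ## §1. The raw term on three directions -/

omit [Fintype ι] [DecidableEq ι] in
/-- **The product-rule integrand on three directions**: `Φ(ω,ψ)[h,k,l] = e^{−U}(C − A_kB_hl − B_hkA_l − A_hB_kl + A_hA_kA_l)` (all at `ω+ψ`).
[folklore] -/
theorem phi_apply [Fintype ι] (U : EuclideanSpace ℝ ι → ℝ) (U' : EuclideanSpace ℝ ι → EuclideanSpace ℝ ι →L[ℝ] ℝ)
    (U'' : EuclideanSpace ℝ ι → EuclideanSpace ℝ ι →L[ℝ] EuclideanSpace ℝ ι →L[ℝ] ℝ)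
    (U₃ : EuclideanSpace ℝ ι → EuclideanSpace ℝ ι →L[ℝ] EuclideanSpace ℝ ι →L[ℝ] EuclideanSpace ℝ ι →L[ℝ] ℝ) (ψ ω h k l : EuclideanSpace ℝ ι) :
    (exp (-U (ω + ψ)) • (U₃ (ω + ψ) - (((ContinuousLinearMap.smulRightL ℝ (EuclideanSpace ℝ ι) (EuclideanSpace ℝ ι →L[ℝ] ℝ)) (U' (ω + ψ))).comp (U'' (ω + ψ)) +
        (((ContinuousLinearMap.smulRightL ℝ (EuclideanSpace ℝ ι) (EuclideanSpace ℝ ι →L[ℝ] ℝ))).comp (U'' (ω + ψ))).flip (U' (ω + ψ)))) + (exp (-U (ω + ψ)) • -U' (ω +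
        ψ)).smulRight (U'' (ω + ψ) - (U' (ω + ψ)).smulRight (U' (ω + ψ)))) h k l = (exp (-U (ω + ψ)) * (U₃ (ω + ψ) h k l - U' (ω + ψ) k * U'' (ω + ψ) h l - U'' (ω + ψ) h k
        * U' (ω + ψ) l - U' (ω + ψ) h * U'' (ω + ψ) k l + U' (ω + ψ) h * U' (ω + ψ) k * U' (ω + ψ) l)) := by
  simp only [_root_.add_apply, _root_.sub_apply, _root_.smul_apply, _root_.neg_apply, ContinuousLinearMap.smulRight_apply,
    ContinuousLinearMap.comp_apply, ContinuousLinearMap.flip_apply, ContinuousLinearMap.smulRightL_apply_apply, smul_eq_mul]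
  ring

/-- **`Φ(·,ψ)` is Bochner integrable** ((418)'s domination at the centre of the ball). [folklore] -/
theorem integrable_phi (hM : M.PosDef) (hΓop : (γop • (1 : Matrix ι ι ℝ) - M⁻¹).PosSemidef) (Y : Finset ι)
    (hUd : ∀ φ : EuclideanSpace ℝ ι, HasFDerivAt U (U' φ) φ) (hU'd : ∀ φ : EuclideanSpace ℝ ι, HasFDerivAt U' (U'' φ) φ)
    (hU''d : ∀ φ : EuclideanSpace ℝ ι, HasFDerivAt U'' (U₃ φ) φ) (hU₃c : Continuous U₃) (hκ₀ : 0 ≤ κ₀) (hκ₁ : 0 ≤ κ₁) (ha : 0 ≤ a) (hκ₂ : 0 ≤ κ₂) (hκ₃ : 0 ≤ κ₃) (hτ : 0 <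
        τ) (hδ : 0 < δ)
    (hθ1 : θ < 1) (hκθ : (2 * κ₀ * (1 + τ) + 4 * δ) * γop ≤ θ) (hstab : ∀ φ : EuclideanSpace ℝ ι, -(κ₀ * ∑ x ∈ Y, φ x ^ 2) ≤ U φ)
    (hU'b : ∀ φ : EuclideanSpace ℝ ι, ‖U' φ‖ ≤ κ₁ * (a + ∑ x ∈ Y, φ x ^ 2)) (hU''b : ∀ φ : EuclideanSpace ℝ ι, ‖U'' φ‖ ≤ κ₂)
    (hU₃b : ∀ φ : EuclideanSpace ℝ ι, ‖U₃ φ‖ ≤ κ₃) (ψ : EuclideanSpace ℝ ι) :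
    Integrable (fun ω : EuclideanSpace ℝ ι => (exp (-U (ω + ψ)) • (U₃ (ω + ψ) - (((ContinuousLinearMap.smulRightL ℝ (EuclideanSpace ℝ ι) (EuclideanSpace ℝ ι →L[ℝ] ℝ)) (U'
        (ω + ψ))).comp (U'' (ω + ψ)) + (((ContinuousLinearMap.smulRightL ℝ (EuclideanSpace ℝ ι) (EuclideanSpace ℝ ι →L[ℝ] ℝ))).comp (U'' (ω + ψ))).flip (U' (ω + ψ)))) +
        (exp (-U (ω + ψ)) • -U' (ω + ψ)).smulRight (U'' (ω + ψ) - (U' (ω + ψ)).smulRight (U' (ω + ψ))))) (multivariateGaussian 0 M⁻¹) := by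
  have hΓ : (M⁻¹).PosSemidef := hM.inv.posSemidef
  exact (integrable_domination hΓ hΓop Y hκ₀ hτ hδ hθ1 hκθ (exp (κ₀ * (1 + τ⁻¹) * (2 * ∑ x ∈ Y, ψ x ^ 2 + 2)) * (κ₁ ^ 3 * (4 * (a + 2 * (2 * ∑ x ∈ Y, ψ x ^ 2 + 2)) ^ 3 + 32
      * (δ ^ 3)⁻¹) + 3 * κ₂ * κ₁ * ((a + 2 * (2 * ∑ x ∈ Y, ψ x ^ 2 + 2)) + δ⁻¹) + κ₃))).mono' (continuous_weightedBlockHess_deriv hUd hU'd hU''d hU₃c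
      ψ).aestronglyMeasurable
    (ae_of_all _ fun ω => block_third_domination_op Y hκ₀ hκ₁ ha hκ₂ hκ₃ hτ hδ hstab hU'b hU''b hU₃b ψ ψ (by rw [sub_self, norm_zero]; exact zero_le_one) ω)

/-- **`(∫Φ)[h,k,l] = ∫Φ[h,k,l]`** (`integral_apply` at three levels). [folklore] -/
theorem integral_phi_apply (hM : M.PosDef) (hΓop : (γop • (1 : Matrix ι ι ℝ) - M⁻¹).PosSemidef) (Y : Finset ι)
    (hUd : ∀ φ : EuclideanSpace ℝ ι, HasFDerivAt U (U' φ) φ) (hU'd : ∀ φ : EuclideanSpace ℝ ι, HasFDerivAt U' (U'' φ) φ)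
    (hU''d : ∀ φ : EuclideanSpace ℝ ι, HasFDerivAt U'' (U₃ φ) φ) (hU₃c : Continuous U₃) (hκ₀ : 0 ≤ κ₀) (hκ₁ : 0 ≤ κ₁) (ha : 0 ≤ a) (hκ₂ : 0 ≤ κ₂) (hκ₃ : 0 ≤ κ₃) (hτ : 0 <
        τ) (hδ : 0 < δ)
    (hθ1 : θ < 1) (hκθ : (2 * κ₀ * (1 + τ) + 4 * δ) * γop ≤ θ) (hstab : ∀ φ : EuclideanSpace ℝ ι, -(κ₀ * ∑ x ∈ Y, φ x ^ 2) ≤ U φ)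
    (hU'b : ∀ φ : EuclideanSpace ℝ ι, ‖U' φ‖ ≤ κ₁ * (a + ∑ x ∈ Y, φ x ^ 2)) (hU''b : ∀ φ : EuclideanSpace ℝ ι, ‖U'' φ‖ ≤ κ₂)
    (hU₃b : ∀ φ : EuclideanSpace ℝ ι, ‖U₃ φ‖ ≤ κ₃) (ψ h k l : EuclideanSpace ℝ ι) :
    (∫ ω : EuclideanSpace ℝ ι, (exp (-U (ω + ψ)) • (U₃ (ω + ψ) - (((ContinuousLinearMap.smulRightL ℝ (EuclideanSpace ℝ ι) (EuclideanSpace ℝ ι →L[ℝ] ℝ)) (U' (ω + ψ))).comp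
        (U'' (ω + ψ)) + (((ContinuousLinearMap.smulRightL ℝ (EuclideanSpace ℝ ι) (EuclideanSpace ℝ ι →L[ℝ] ℝ))).comp (U'' (ω + ψ))).flip (U' (ω + ψ)))) + (exp (-U (ω + ψ))
        • -U' (ω + ψ)).smulRight (U'' (ω + ψ) - (U' (ω + ψ)).smulRight (U' (ω + ψ)))) ∂(multivariateGaussian 0 M⁻¹)) h k l = (∫ ω : EuclideanSpace ℝ ι, (exp (-U (ω + ψ)) *
        (U₃ (ω + ψ) h k l - U' (ω + ψ) k * U'' (ω + ψ) h l - U'' (ω + ψ) h k * U' (ω + ψ) l - U' (ω + ψ) h * U'' (ω + ψ) k l + U' (ω + ψ) h * U' (ω + ψ) k * U' (ω + ψ) l))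
        ∂(multivariateGaussian 0 M⁻¹)) := by
  have hI := integrable_phi hM hΓop Y hUd hU'd hU''d hU₃c hκ₀ hκ₁ ha hκ₂ hκ₃ hτ hδ hθ1 hκθ hstab hU'b hU''b hU₃b ψ
  have hI1 : Integrable (fun ω : EuclideanSpace ℝ ι => (exp (-U (ω + ψ)) • (U₃ (ω + ψ) - (((ContinuousLinearMap.smulRightL ℝ (EuclideanSpace ℝ ι) (EuclideanSpace ℝ ι →L[ℝ]
      ℝ)) (U' (ω + ψ))).comp (U'' (ω + ψ)) + (((ContinuousLinearMap.smulRightL ℝ (EuclideanSpace ℝ ι) (EuclideanSpace ℝ ι →L[ℝ] ℝ))).comp (U'' (ω + ψ))).flip (U' (ω + ψ))))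
      + (exp (-U (ω + ψ)) • -U' (ω + ψ)).smulRight (U'' (ω + ψ) - (U' (ω + ψ)).smulRight (U' (ω + ψ)))) h) (multivariateGaussian 0 M⁻¹) :=
    (ContinuousLinearMap.apply ℝ (EuclideanSpace ℝ ι →L[ℝ] EuclideanSpace ℝ ι →L[ℝ] ℝ) h).integrable_comp hI
  have hI2 : Integrable (fun ω : EuclideanSpace ℝ ι => (exp (-U (ω + ψ)) • (U₃ (ω + ψ) - (((ContinuousLinearMap.smulRightL ℝ (EuclideanSpace ℝ ι) (EuclideanSpace ℝ ι →L[ℝ]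
      ℝ)) (U' (ω + ψ))).comp (U'' (ω + ψ)) + (((ContinuousLinearMap.smulRightL ℝ (EuclideanSpace ℝ ι) (EuclideanSpace ℝ ι →L[ℝ] ℝ))).comp (U'' (ω + ψ))).flip (U' (ω + ψ))))
      + (exp (-U (ω + ψ)) • -U' (ω + ψ)).smulRight (U'' (ω + ψ) - (U' (ω + ψ)).smulRight (U' (ω + ψ)))) h k) (multivariateGaussian 0 M⁻¹) :=
    (ContinuousLinearMap.apply ℝ (EuclideanSpace ℝ ι →L[ℝ] ℝ) k).integrable_comp hI1
  rw [ContinuousLinearMap.integral_apply hI h, ContinuousLinearMap.integral_apply hI1 k, ContinuousLinearMap.integral_apply hI2 l]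
  exact integral_congr_ae (ae_of_all _ fun ω => phi_apply U U' U'' U₃ ψ ω h k l)

/-- `G[v] = ∫e^{−U}A_v`. [folklore] -/
theorem integral_G_apply (hM : M.PosDef) (hΓop : (γop • (1 : Matrix ι ι ℝ) - M⁻¹).PosSemidef) (Y : Finset ι)
    (hUd : ∀ φ : EuclideanSpace ℝ ι, HasFDerivAt U (U' φ) φ) (hU'd : ∀ φ : EuclideanSpace ℝ ι, HasFDerivAt U' (U'' φ) φ)
    (hκ₀ : 0 ≤ κ₀) (hκ₁ : 0 ≤ κ₁) (ha : 0 ≤ a) (hτ : 0 < τ) (hδ : 0 < δ)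
    (hθ1 : θ < 1) (hκθ : (2 * κ₀ * (1 + τ) + 4 * δ) * γop ≤ θ) (hstab : ∀ φ : EuclideanSpace ℝ ι, -(κ₀ * ∑ x ∈ Y, φ x ^ 2) ≤ U φ)
    (hU'b : ∀ φ : EuclideanSpace ℝ ι, ‖U' φ‖ ≤ κ₁ * (a + ∑ x ∈ Y, φ x ^ 2)) (ψ v : EuclideanSpace ℝ ι) :
    (∫ ω : EuclideanSpace ℝ ι, exp (-U (ω + ψ)) • U' (ω + ψ) ∂(multivariateGaussian 0 M⁻¹)) v = (∫ ω : EuclideanSpace ℝ ι, exp (-U (ω + ψ)) * U' (ω + ψ) v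
        ∂(multivariateGaussian 0 M⁻¹)) := by
  have hΓ : (M⁻¹).PosSemidef := hM.inv.posSemidef
  have hU'c : Continuous U' := continuous_iff_continuousAt.2 fun φ => (hU'd φ).continuousAt
  rw [ContinuousLinearMap.integral_apply (integrable_weighted_blockDeriv hΓ hΓop Y hUd hU'c hκ₀ hκ₁ ha hτ hδ hθ1 hκθ hstab hU'b ψ)]
  exact integral_congr_ae (ae_of_all _ fun ω => by simp only [_root_.smul_apply, smul_eq_mul])

/-- `H[v,w] = ∫e^{−U}(B_vw − A_vA_w)`. [folklore] -/
theorem integral_H_apply (hM : M.PosDef) (hΓop : (γop • (1 : Matrix ι ι ℝ) - M⁻¹).PosSemidef) (Y : Finset ι)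
    (hUd : ∀ φ : EuclideanSpace ℝ ι, HasFDerivAt U (U' φ) φ) (hU'd : ∀ φ : EuclideanSpace ℝ ι, HasFDerivAt U' (U'' φ) φ)
    (hU''d : ∀ φ : EuclideanSpace ℝ ι, HasFDerivAt U'' (U₃ φ) φ) (hκ₀ : 0 ≤ κ₀) (hκ₁ : 0 ≤ κ₁) (ha : 0 ≤ a) (hκ₂ : 0 ≤ κ₂) (hτ : 0 < τ) (hδ : 0 < δ)
    (hθ1 : θ < 1) (hκθ : (2 * κ₀ * (1 + τ) + 4 * δ) * γop ≤ θ) (hstab : ∀ φ : EuclideanSpace ℝ ι, -(κ₀ * ∑ x ∈ Y, φ x ^ 2) ≤ U φ)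
    (hU'b : ∀ φ : EuclideanSpace ℝ ι, ‖U' φ‖ ≤ κ₁ * (a + ∑ x ∈ Y, φ x ^ 2)) (hU''b : ∀ φ : EuclideanSpace ℝ ι, ‖U'' φ‖ ≤ κ₂) (ψ v w : EuclideanSpace ℝ ι) :
    (∫ ω : EuclideanSpace ℝ ι, exp (-U (ω + ψ)) • (U'' (ω + ψ) - (U' (ω + ψ)).smulRight (U' (ω + ψ))) ∂(multivariateGaussian 0 M⁻¹)) v w = (∫ ω : EuclideanSpace ℝ ι, exp
        (-U (ω + ψ)) * (U'' (ω + ψ) v w - U' (ω + ψ) v * U' (ω + ψ) w) ∂(multivariateGaussian 0 M⁻¹)) := by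
  have hΓ : (M⁻¹).PosSemidef := hM.inv.posSemidef
  have hU''c : Continuous U'' := continuous_iff_continuousAt.2 fun φ => (hU''d φ).continuousAt
  have hHint := integrable_weightedBlockHess hΓ hΓop Y hUd hU'd hU''c hκ₀ hκ₁ ha hκ₂ hτ hδ hθ1 hκθ hstab hU'b hU''b ψ
  have hH1 : Integrable (fun ω : EuclideanSpace ℝ ι => (exp (-U (ω + ψ)) • (U'' (ω + ψ) - (U' (ω + ψ)).smulRight (U' (ω + ψ)))) v) (multivariateGaussian 0 M⁻¹) :=
    (ContinuousLinearMap.apply ℝ (EuclideanSpace ℝ ι →L[ℝ] ℝ) v).integrable_comp hHint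
  rw [ContinuousLinearMap.integral_apply hHint v, ContinuousLinearMap.integral_apply hH1 w]
  exact integral_congr_ae (ae_of_all _ fun ω => by
    simp only [_root_.smul_apply, _root_.sub_apply, smul_eq_mul, ContinuousLinearMap.smulRight_apply])

/-- **THE RAW TERM ON THREE DIRECTIONS**: `T(ψ)[h,k,l] = Z⁻¹∫Φ[h,k,l] + Z⁻²(G_hH_kl + G_kH_hl + H_hkG_l) + 2Z⁻³G_hG_kG_l` written with the
scalar integrals. [folklore] -/
theorem hessW_deriv_apply (hM : M.PosDef) (hΓop : (γop • (1 : Matrix ι ι ℝ) - M⁻¹).PosSemidef) (Y : Finset ι)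
    (hUd : ∀ φ : EuclideanSpace ℝ ι, HasFDerivAt U (U' φ) φ) (hU'd : ∀ φ : EuclideanSpace ℝ ι, HasFDerivAt U' (U'' φ) φ)
    (hU''d : ∀ φ : EuclideanSpace ℝ ι, HasFDerivAt U'' (U₃ φ) φ) (hU₃c : Continuous U₃) (hκ₀ : 0 ≤ κ₀) (hκ₁ : 0 ≤ κ₁) (ha : 0 ≤ a) (hκ₂ : 0 ≤ κ₂) (hκ₃ : 0 ≤ κ₃) (hτ : 0 <
        τ) (hδ : 0 < δ)
    (hθ1 : θ < 1) (hκθ : (2 * κ₀ * (1 + τ) + 4 * δ) * γop ≤ θ) (hstab : ∀ φ : EuclideanSpace ℝ ι, -(κ₀ * ∑ x ∈ Y, φ x ^ 2) ≤ U φ)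
    (hU'b : ∀ φ : EuclideanSpace ℝ ι, ‖U' φ‖ ≤ κ₁ * (a + ∑ x ∈ Y, φ x ^ 2)) (hU''b : ∀ φ : EuclideanSpace ℝ ι, ‖U'' φ‖ ≤ κ₂)
    (hU₃b : ∀ φ : EuclideanSpace ℝ ι, ‖U₃ φ‖ ≤ κ₃) (ψ h k l : EuclideanSpace ℝ ι) :
    (((∫ ω : EuclideanSpace ℝ ι, exp (-U (ω + ψ)) ∂(multivariateGaussian 0 M⁻¹))⁻¹ • (∫ ω : EuclideanSpace ℝ ι, (exp (-U (ω + ψ)) • (U₃ (ω + ψ) -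
        (((ContinuousLinearMap.smulRightL ℝ (EuclideanSpace ℝ ι) (EuclideanSpace ℝ ι →L[ℝ] ℝ)) (U' (ω + ψ))).comp (U'' (ω + ψ)) + (((ContinuousLinearMap.smulRightL ℝ
        (EuclideanSpace ℝ ι) (EuclideanSpace ℝ ι →L[ℝ] ℝ))).comp (U'' (ω + ψ))).flip (U' (ω + ψ)))) + (exp (-U (ω + ψ)) • -U' (ω + ψ)).smulRight (U'' (ω + ψ) - (U' (ω +
        ψ)).smulRight (U' (ω + ψ)))) ∂(multivariateGaussian 0 M⁻¹)) + ((-((∫ ω : EuclideanSpace ℝ ι, exp (-U (ω + ψ)) ∂(multivariateGaussian 0 M⁻¹)) ^ 2)⁻¹) • -(∫ ω :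
        EuclideanSpace ℝ ι, exp (-U (ω + ψ)) • U' (ω + ψ) ∂(multivariateGaussian 0 M⁻¹))).smulRight (∫ ω : EuclideanSpace ℝ ι, exp (-U (ω + ψ)) • (U'' (ω + ψ) - (U' (ω +
        ψ)).smulRight (U' (ω + ψ))) ∂(multivariateGaussian 0 M⁻¹))) + (((ContinuousLinearMap.smulRightL ℝ (EuclideanSpace ℝ ι) (EuclideanSpace ℝ ι →L[ℝ] ℝ)) (((∫ ω :
        EuclideanSpace ℝ ι, exp (-U (ω + ψ)) ∂(multivariateGaussian 0 M⁻¹)) ^ 2)⁻¹ • (∫ ω : EuclideanSpace ℝ ι, exp (-U (ω + ψ)) • U' (ω + ψ) ∂(multivariateGaussian 0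
        M⁻¹)))).comp (∫ ω : EuclideanSpace ℝ ι, exp (-U (ω + ψ)) • (U'' (ω + ψ) - (U' (ω + ψ)).smulRight (U' (ω + ψ))) ∂(multivariateGaussian 0 M⁻¹)) +
        (((ContinuousLinearMap.smulRightL ℝ (EuclideanSpace ℝ ι) (EuclideanSpace ℝ ι →L[ℝ] ℝ))).comp (((∫ ω : EuclideanSpace ℝ ι, exp (-U (ω + ψ)) ∂(multivariateGaussian 0
        M⁻¹)) ^ 2)⁻¹ • (∫ ω : EuclideanSpace ℝ ι, exp (-U (ω + ψ)) • (U'' (ω + ψ) - (U' (ω + ψ)).smulRight (U' (ω + ψ))) ∂(multivariateGaussian 0 M⁻¹)) + ((-2 / (∫ ω :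
        EuclideanSpace ℝ ι, exp (-U (ω + ψ)) ∂(multivariateGaussian 0 M⁻¹)) ^ 3) • -(∫ ω : EuclideanSpace ℝ ι, exp (-U (ω + ψ)) • U' (ω + ψ) ∂(multivariateGaussian 0
        M⁻¹))).smulRight (∫ ω : EuclideanSpace ℝ ι, exp (-U (ω + ψ)) • U' (ω + ψ) ∂(multivariateGaussian 0 M⁻¹)))).flip (∫ ω : EuclideanSpace ℝ ι, exp (-U (ω + ψ)) • U' (ω
        + ψ) ∂(multivariateGaussian 0 M⁻¹)))) h k l =
      ((∫ ω : EuclideanSpace ℝ ι, exp (-U (ω + ψ)) ∂(multivariateGaussian 0 M⁻¹))⁻¹ * (∫ ω : EuclideanSpace ℝ ι, (exp (-U (ω + ψ)) * (U₃ (ω + ψ) h k l - U' (ω + ψ) k * U''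
          (ω + ψ) h l - U'' (ω + ψ) h k * U' (ω + ψ) l - U' (ω + ψ) h * U'' (ω + ψ) k l + U' (ω + ψ) h * U' (ω + ψ) k * U' (ω + ψ) l)) ∂(multivariateGaussian 0 M⁻¹)) + ((∫
          ω : EuclideanSpace ℝ ι, exp (-U (ω + ψ)) ∂(multivariateGaussian 0 M⁻¹)) ^ 2)⁻¹ * (∫ ω : EuclideanSpace ℝ ι, exp (-U (ω + ψ)) * U' (ω + ψ) h ∂(multivariateGaussian
          0 M⁻¹)) * (∫ ω : EuclideanSpace ℝ ι, exp (-U (ω + ψ)) * (U'' (ω + ψ) k l - U' (ω + ψ) k * U' (ω + ψ) l) ∂(multivariateGaussian 0 M⁻¹)) + ((∫ ω : EuclideanSpace ℝ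
          ι, exp (-U (ω + ψ)) ∂(multivariateGaussian 0 M⁻¹)) ^ 2)⁻¹ * (∫ ω : EuclideanSpace ℝ ι, exp (-U (ω + ψ)) * U' (ω + ψ) k ∂(multivariateGaussian 0 M⁻¹)) * (∫ ω :
          EuclideanSpace ℝ ι, exp (-U (ω + ψ)) * (U'' (ω + ψ) h l - U' (ω + ψ) h * U' (ω + ψ) l) ∂(multivariateGaussian 0 M⁻¹)) + (((∫ ω : EuclideanSpace ℝ ι, exp (-U (ω +
          ψ)) ∂(multivariateGaussian 0 M⁻¹)) ^ 2)⁻¹ * (∫ ω : EuclideanSpace ℝ ι, exp (-U (ω + ψ)) * (U'' (ω + ψ) h k - U' (ω + ψ) h * U' (ω + ψ) k) ∂(multivariateGaussian 0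
          M⁻¹)) + -2 / (∫ ω : EuclideanSpace ℝ ι, exp (-U (ω + ψ)) ∂(multivariateGaussian 0 M⁻¹)) ^ 3 * -(∫ ω : EuclideanSpace ℝ ι, exp (-U (ω + ψ)) * U' (ω + ψ) h
          ∂(multivariateGaussian 0 M⁻¹)) * (∫ ω : EuclideanSpace ℝ ι, exp (-U (ω + ψ)) * U' (ω + ψ) k ∂(multivariateGaussian 0 M⁻¹))) * (∫ ω : EuclideanSpace ℝ ι, exp (-U
          (ω + ψ)) * U' (ω + ψ) l ∂(multivariateGaussian 0 M⁻¹))) := by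
  simp only [_root_.add_apply, _root_.smul_apply, ContinuousLinearMap.smulRight_apply, ContinuousLinearMap.comp_apply,
    ContinuousLinearMap.flip_apply, ContinuousLinearMap.smulRightL_apply_apply, smul_eq_mul, _root_.neg_apply]
  rw [integral_phi_apply hM hΓop Y hUd hU'd hU''d hU₃c hκ₀ hκ₁ ha hκ₂ hκ₃ hτ hδ hθ1 hκθ hstab hU'b hU''b hU₃b ψ h k l, integral_G_apply hM hΓop Y hUd hU'd hκ₀ hκ₁ ha hτ hδ
      hθ1 hκθ hstab hU'b ψ h, integral_G_apply hM hΓop Y hUd hU'd hκ₀ hκ₁ ha hτ hδ hθ1 hκθ hstab hU'b ψ k, integral_G_apply hM hΓop Y hUd hU'd hκ₀ hκ₁ ha hτ hδ hθ1 hκθ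
      hstab hU'b ψ l,
    integral_H_apply hM hΓop Y hUd hU'd hU''d hκ₀ hκ₁ ha hκ₂ hτ hδ hθ1 hκθ hstab hU'b hU''b ψ k l, integral_H_apply hM hΓop Y hUd hU'd hU''d hκ₀ hκ₁ ha hκ₂ hτ hδ hθ1 hκθ
        hstab hU'b hU''b ψ h l, integral_H_apply hM hΓop Y hUd hU'd hU''d hκ₀ hκ₁ ha hκ₂ hτ hδ hθ1 hκθ hstab hU'b hU''b ψ h k]
  ring

end Main

/-! ## §2. Toy -/

/-- Toy (§1's algebra): the sign pattern of the product rule. -/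
example (e c ak bhl bhk al ah bkl : ℝ) : e * (c - (ak * bhl + bhk * al)) + (e * -ah) * (bkl - ak * al) = e * (c - ak * bhl - bhk * al - ah * bkl + ah * ak * al) := by
  ring

end Summit.QuantumFields.BalabanUV.T4Continuum.NE7b.SupBlockThirdCumulantForm
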